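import Summits.BirchSwinnertonDyer.Rank1Residual.X11a.ChainSocket
import Summits.BirchSwinnertonDyer.Rank1Residual.X11a.ChainHeightFree
import HarnessLib

/-!
# Class X11a: the abstract-interface SOCKET on THE (bounded) cyclotomic `p`-adic `L`-function
# (cell `b2b-bsdres`, unit `b2b-bsdres-x11a`, gen 19; successor of the shapes of `X11a/ChainSocket.lean`)

HONEST FRAMING (run/shared/lean/b2b/bsd-rank1-residual/, verbatim in every file): the goal of the
cell is to DELETE the COMBINATION-SHAPED residual classes of the Birch–Swinnerton-Dyer formula for
ALL analytic-rank `≤ 1` elliptic curves over `ℚ` — "full BSD formula for every rank `≤ 1` curve in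
class `C`" assembled STRICTLY from published theorems — so that the rank-`≤ 1` remainder becomes
exactly the CONSTRUCTION-SHAPED classes, which are TYPED (missing-input `Prop`s), NOT attempted.
This is not "finishing BSD". Research route; NO CLAIM BEYOND STATED CLASSES. Two `Prop`-valued
definitions (STATEMENT SHAPES — typed inputs, nothing asserted, no named fact) and theorems.

WHY THIS FILE (referee R121.2, recipe HOME/b2b-bsdres-lit-su/SU2014-TYPING.md §8.3 item 2).
`X11a/ChainSocket.lean` (gen 15) writes Wan 2015 Thm. 4 and EPW 2006 Thm. 1 / 5.1.3 over an ABSTRACT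
algebraic interface (`MuAlgZero`, `lamAlg`) as the hypothesis shapes `WanLambdaAt`,
`InvariantsTransferAt`. Both quantify over EVERY `L : ℚ̄_p⟦T⟧` with the bare interpolation predicate
`IsCycPAdicLFunctionWeightK g D p ι υ L`, which does not determine `L` (`L ↦ L + log(1+T)` keeps it:
zero constant term, `log_p ζ = 0`), while `WanLambdaAt` concludes `HasMaxCoeff L` — false for an
unbounded series. So, exactly like the retired named facts A86/A87, the gen-15 shapes are
UNSATISFIABLE as soon as their data exist: a chain theorem taking `h2 : WanLambdaAt …` is vacuous
in `h2` (vacuity risk only — shapes are hypotheses, nothing was asserted; finding of `lit-su`). In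
print Wan's `𝓛_f` is THE `p`-adic `L`-function, an element of `Λ_{ℚ,𝒪_L}`, i.e. the BOUNDED
interpolant, unique among bounded interpolants (tree theorem
`ModularForms.IsCycPAdicLFunctionWeightK.eq_of_bounded`, `CyclotomicInterpolantUniquenessProofs.lean`).

THIS FILE gives the print-faithful shapes — the same statements with ONE more binder
`(∃ C : ℝ, ∀ i, ‖PowerSeries.coeff i L‖ ≤ C) →` right after the interpolation predicate:
`WanLambdaBddAt`, `InvariantsTransferBddAt` (each WEAKER than its gen-15 shape:
`WanLambdaBddAt.of_unrestricted`, `InvariantsTransferBddAt.of_unrestricted`) — and re-runs the glue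
with the boundedness clause of the Mazur–Tate–Teitelbaum existence theorem KEPT:
`invariantsAt_normLam_of_chain_bdd` (same proof as `invariantsAt_normLam_of_chain`, one `obtain`
pattern and two applications changed), `bsdp_of_chain_bdd_heightFree` and the class-level
`X11a.forall_bsdp_of_chain_bdd_heightFree` (the gen-18 height-fact-free rank-`0` endpoint, so the
Stein–Wuthrich height-existence binders `hHs`/`hHn` of `bsdp_of_chain` are gone too, and the MTT
existence fact is the tree theorem `exists_isCycPAdicLFunctionWeightK_holds`). By uniqueness
(`existsUnique_isCycPAdicLFunctionWeightK_bounded`, lit-su) the bounded shapes speak about ONE series: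
quantifying "over all bounded interpolants" and "over THE bounded interpolant" is the same thing.
The gen-15 shapes and glue stay in the tree (append-only) and are DEPRECATED. The chain OF RECORD is
not this socket but the discharge on harvest-2's (V-alg) vocabulary (`X11a/ChainBounded*.lean`);
the socket remains the abstract-interface route for any future algebraic vocabulary. No label change
(cell lead / referee).

References: [Wan2015] Thm. 4 (pp. 4–5) = Thm. 103 (pp. 91–92); [EmertonPollackWeston2006] Thm. 1,
Thm. 5.1.2, Thm. 5.1.3, Ex. 5.3.1; [MazurTateTeitelbaum1986Invent] §I.11, §I.14 (14.3);
[SteinWuthrich2013] Thm. 6.1; HOME/b2b-bsdres-lit-su/SU2014-TYPING.md §5, §8, §9.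
-/

noncomputable section

open scoped Classical MatrixGroups ModularForm

open CongruenceSubgroup WeierstrassCurve Literature.NumberTheory.EllipticCurves
  Literature.NumberTheory.EllipticCurves.ModularForms
  Literature.NumberTheory.EllipticCurves.Rank1Residual
  Literature.NumberTheory.EllipticCurves.Rank1Residual.Typed
  Literature.NumberTheory.EllipticCurves.Wuthrich2014
  Literature.NumberTheory.EllipticCurves.SteinWuthrich2013
  Literature.NumberTheory.EllipticCurves.GreenbergVatsal2000
  Summit.BirchSwinnertonDyer.Rank1Residual.X1.MuLambda
  Summit.BirchSwinnertonDyer.Rank1Residual.X11a.LambdaNorm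

set_option autoImplicit false

namespace Summit.BirchSwinnertonDyer.Rank1Residual.X11a.Chain

variable (W : WeierstrassCurve ℚ) [W.IsElliptic] [W.IsGloballyMinimal] (p : ℕ) [Fact p.Prime]

/-! ### The two print-faithful shapes -/

/-- **Shape of X. Wan, Forum Math. Sigma 3 (2015) e18, Thm. 4 (= Thm. 103), RATIONAL part, at a
good-ordinary member of `H(E[p])` with `E[p]` surjective, read as its `λ`-corollary — over THE
(bounded) cyclotomic `p`-adic `L`-function**: as `WanLambdaAt`, with the analytic side quantified AS
PRINTED, i.e. over the interpolants `L` of `IsCycPAdicLFunctionWeightK g D p ι υ` whose coefficients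
are BOUNDED (`Wan's 𝓛_f ∈ Λ_{ℚ,𝒪_L}`; unique among bounded interpolants by
`IsCycPAdicLFunctionWeightK.eq_of_bounded`): `MuAlgZero g ι` ⇒ `HasMaxCoeff L ∧ λ^alg(g) = normLam L`.
Typed shape over the abstract interface; nothing asserted.
[cite: Wan2015, Thm. 4 (pp. 4–5) = Thm. 103 (pp. 91–92) (shape only; nothing asserted)]
[cite: EmertonPollackWeston2006, Thm. 3.1.1 and Def. 4.4.6 (shape only)]
[cite: MazurTateTeitelbaum1986Invent, §I.11 and §I.14 (14.3)] -/
def WanLambdaBddAt [NeZero (W.conductorNorm ℤ / p)]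
    (MuAlgZero : MuAlgPred p (W.conductorNorm ℤ / p))
    (lamAlg : LamAlgFun p (W.conductorNorm ℤ / p)) : Prop :=
  W.HasSurjectiveModNGaloisRep p →
    ∀ {k : ℤ} (g : CuspForm (Gamma0 (W.conductorNorm ℤ / p)) k) (ι : coeffField g →+* PadicAlgCl p),
      IsMember W p g ι → MuAlgZero g ι →
      ∀ (υ : PadicAlgCl p) (D : PeriodSymbolDatum g) (L : PowerSeries (PadicAlgCl p)),
        υ ^ 2 - ι ⟨(UpperHalfPlane.qExpansion 1 ⇑g).coeff p, coeff_mem_coeffField g p⟩ * υ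
            + (p : PadicAlgCl p) ^ (k - 1).toNat = 0 →
        ‖υ‖ = 1 → IsCycPAdicLFunctionWeightK g D p ι υ L →
        (∃ C : ℝ, ∀ i, ‖PowerSeries.coeff i L‖ ≤ C) →
        HasMaxCoeff L ∧ lamAlg g ι = normLam L

/-- **Shape of EPW Thm. 1 (analytic, `f_E ↦ g`) with Thm. 5.1.3 (source `f₀ = g`, target `f = f_E`)
— over THE (bounded) cyclotomic `p`-adic `L`-function of `(g, ι)`**: as `InvariantsTransferAt`,
with the interpolant `L` restricted to the bounded ones (the printed `L_p(g)` of EPW §3.3 is the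
Mazur–Tate–Teitelbaum measure's transform, bounded). Conclusion at `f_E` in the tree's normalisation:
at every Kato pair `(gK, fE)` unit contents and `normLam gK = normLam fE`. Typed shape over the
abstract interface; nothing asserted.
[cite: EmertonPollackWeston2006, Thm. 1, Thm. 5.1.3, Thm. 5.1.2 and Ex. 5.3.1 (shape only; nothing asserted)]
[cite: Skinner2016PacificMC, §3.2 and §3.3 (shape only)]
[cite: MazurTateTeitelbaum1986Invent, §I.11 and §I.14 (14.3)] -/
def InvariantsTransferBddAt [NeZero (W.conductorNorm ℤ / p)]
    (MuAlgZero : MuAlgPred p (W.conductorNorm ℤ / p))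
    (lamAlg : LamAlgFun p (W.conductorNorm ℤ / p)) : Prop :=
  ∀ {k : ℤ} (g : CuspForm (Gamma0 (W.conductorNorm ℤ / p)) k) (ι : coeffField g →+* PadicAlgCl p),
    IsMember W p g ι →
    ∀ (υ : PadicAlgCl p) (D : PeriodSymbolDatum g) (L : PowerSeries (PadicAlgCl p)),
      υ ^ 2 - ι ⟨(UpperHalfPlane.qExpansion 1 ⇑g).coeff p, coeff_mem_coeffField g p⟩ * υ
          + (p : PadicAlgCl p) ^ (k - 1).toNat = 0 →
      ‖υ‖ = 1 → IsCycPAdicLFunctionWeightK g D p ι υ L →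
      (∃ C : ℝ, ∀ i, ‖PowerSeries.coeff i L‖ ≤ C) →
      MuAlgZero g ι → lamAlg g ι = normLam L →
      MuAnZeroAt W p →
      InvariantsAt W p fun gK fE => HasUnitContent gK ∧ HasUnitContent fE ∧ normLam gK = normLam fE

variable {W p}

omit [W.IsElliptic] in
/-- The bounded Wan shape is WEAKER than the unrestricted `WanLambdaAt` (it drops instances).
[cite: Wan2015, Thm. 4 (pp. 4–5) = Thm. 103 (pp. 91–92) (shape only)] -/
theorem WanLambdaBddAt.of_unrestricted [NeZero (W.conductorNorm ℤ / p)]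
    {MuAlgZero : MuAlgPred p (W.conductorNorm ℤ / p)} {lamAlg : LamAlgFun p (W.conductorNorm ℤ / p)}
    (h : WanLambdaAt W p MuAlgZero lamAlg) : WanLambdaBddAt W p MuAlgZero lamAlg := by
  intro hsurj k g ι hmem hMu υ D L hroot hunit hL _
  exact h hsurj g ι hmem hMu υ D L hroot hunit hL

/-- The bounded transfer shape is WEAKER than the unrestricted `InvariantsTransferAt`.
[cite: EmertonPollackWeston2006, Thm. 1 and Thm. 5.1.3 (shape only)] -/
theorem InvariantsTransferBddAt.of_unrestricted [NeZero (W.conductorNorm ℤ / p)]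
    {MuAlgZero : MuAlgPred p (W.conductorNorm ℤ / p)} {lamAlg : LamAlgFun p (W.conductorNorm ℤ / p)}
    (h : InvariantsTransferAt W p MuAlgZero lamAlg) : InvariantsTransferBddAt W p MuAlgZero lamAlg := by
  intro k g ι hmem υ D L hroot hunit hL _ hMu hlam hμ
  exact h g ι hmem υ D L hroot hunit hL hMu hlam hμ

variable (W p)

/-! ### The glue on the bounded shapes -/

/-- **The chain at a pair, in the `normLam` currency, on the BOUNDED shapes** (successor of
`invariantsAt_normLam_of_chain`; same proof with the boundedness clause of the Mazur–Tate–Teitelbaum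
existence fact kept and fed to `h2`/`h1b`). From [L1] Hida's member (`hHida`), the MTT existence
fact (`hMTT`), Shimura's period datum and the unit root (PROVED), the three GL₂ shapes (`h1a`, `h2`,
`h1b` — hypotheses over ANY algebraic interface), Kato A32 (`hKato`) with a modular parametrisation
(`hpar`), at a multiplicative `p ≥ 5` with `ρ̄_{E,p}` surjective and the certificate `MuAnZeroAt W p`:
every Kato pair `(gK, fE)` has unit contents and `normLam gK = normLam fE`.
[cite: EmertonPollackWeston2006, Thm. 1, Thm. 5.1.3, Ex. 5.3.1] [cite: Wan2015, Thm. 4 (pp. 4–5) = Thm. 103 (pp. 91–92)]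
[cite: MazurTateTeitelbaum1986Invent, §I.11 and §I.14 (14.3)] -/
theorem invariantsAt_normLam_of_chain_bdd [NeZero (W.conductorNorm ℤ / p)]
    {MuAlgZero : MuAlgPred p (W.conductorNorm ℤ / p)} {lamAlg : LamAlgFun p (W.conductorNorm ℤ / p)}
    (hHida : hida_exists_congruent_ordinary_newform_of_multiplicative)
    (hMTT : exists_isCycPAdicLFunctionWeightK)
    (hKato : kato_charIdeal_dvd_multiplicative_of_surjective)
    (hpar : nonempty_modularParametrizationData)
    (h1a : MuAlgTransferAt W p MuAlgZero) (h2 : WanLambdaBddAt W p MuAlgZero lamAlg)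
    (h1b : InvariantsTransferBddAt W p MuAlgZero lamAlg)
    (hp : 5 ≤ p) (hmult : W.HasMultiplicativeReductionAtPrime p)
    (hsurj : W.HasSurjectiveModNGaloisRep p) (hμ : MuAnZeroAt W p) :
    InvariantsAt W p fun gK fE => HasUnitContent gK ∧ HasUnitContent fE ∧ normLam gK = normLam fE := by
  -- adapted from `invariantsAt_normLam_of_chain` (X11a/ChainSocket.lean, gen 15)
  have hprime : p.Prime := Fact.out
  have hp2 : p ≠ 2 := by omega
  -- [L1]: the weight-`k` member, `k = (p − 1) + 2`
  set n : ℕ := p - 1 with hn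
  have hn0 : n ≠ 0 := by omega
  have hneven : Even n := hn ▸ hprime.even_sub_one hp2
  have hk2 : (2 : ℤ) < (n : ℤ) + 2 := by omega
  have hkdvd : ((p : ℤ) - 1) ∣ ((n : ℤ) + 2 - 2) := by
    refine ⟨1, ?_⟩
    rw [hn, Nat.cast_sub hprime.one_le]; push_cast; ring
  obtain ⟨g, ι, hg, hap, hcong⟩ := hHida W p hp hmult inferInstance ((n : ℤ) + 2) hk2 hkdvd
  have hmem : IsMember W p g ι := ⟨hk2, hkdvd, hg, hap, hcong⟩
  -- Shimura's period datum and the unit root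
  obtain ⟨D⟩ := IsNewform0.nonempty_periodSymbolDatum hneven hn0 hg
  have hc : ‖(p : PadicAlgCl p) ^ ((n : ℤ) + 2 - 1).toNat‖ < 1 := by
    rw [norm_pow, show ((n : ℤ) + 2 - 1).toNat = n + 1 by omega]
    have hpn : ‖(p : PadicAlgCl p)‖ < 1 := by
      rw [← map_natCast (algebraMap ℚ_[p] (PadicAlgCl p)), norm_algebraMap', Padic.norm_p]
      exact inv_lt_one_of_one_lt₀ (by exact_mod_cast hprime.one_lt)
    exact pow_lt_one₀ (norm_nonneg _) hpn (by omega)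
  obtain ⟨υ, hroot, hunit⟩ := exists_unitRoot p hap hc
  -- THE (bounded) cyclotomic `p`-adic `L`-function of `(g, ι)`: the boundedness clause is KEPT
  obtain ⟨L, hL, hbd, -⟩ := hMTT g hg (by omega) p (not_dvd_conductorNorm_div W p hmult) ι υ hroot
    hunit D
  -- [L4]: `μ(X(E/ℚ_∞)) = 0` for every cyclotomic / dual datum, from the certificate
  have hμalg : ∀ (κ : ZpExtension ℚ p) (γ : Field.absoluteGaloisGroup ℚ), κ.IsCyclotomic →
      κ.IsTopGenerator γ → IsCyclotomicVariable p γ →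
      ∀ D' : W.SelmerDualData κ γ, D'.IsTorsion ∧ D'.mu = 0 :=
    fun κ γ hκ hγ hγ' D' =>
      ⟨(isTorsion_and_exists_generator_hasUnitContent_of_muAnZeroAt W p hKato hpar hp hmult hsurj hμ
          hκ hγ hγ' D').1,
        selmerDual_mu_eq_zero_of_muAnZeroAt W p hKato hpar hp hmult hsurj hμ hκ hγ hγ' D'⟩
  -- EPW Thm. 1 (alg): `μ^alg(g) = 0`; Wan (bounded): `λ^alg(g) = λ^an(g)`; EPW Thm. 1 (an) + 5.1.3
  have hMu : MuAlgZero g ι := h1a hμalg g ι hmem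
  have hlam : lamAlg g ι = normLam L := (h2 hsurj g ι hmem hMu υ D L hroot hunit hL hbd).2
  exact h1b g ι hmem υ D L hroot hunit hL hbd hMu hlam hμ

/-- **`BSD(E,p)` at a pair of X11a's surjective leaf from the chain on the BOUNDED shapes,
height-fact-free** (`r_an = 0`): successor of `bsdp_of_chain` — the rank-`0` endpoint is the gen-18
`bsdp_of_invariantsMatchAt_heightFree` (Kato A32, Stein–Wuthrich Thm. 6.1, Greenberg–Stevens, GZK,
modularity; NO Stein–Wuthrich height-existence fact), so the binders `hHs`/`hHn` of `bsdp_of_chain`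
are gone as well. [cite: EmertonPollackWeston2006, Thm. 5.1.2 and Thm. 5.1.3]
[cite: Wan2015, Thm. 4 (pp. 4–5) = Thm. 103 (pp. 91–92)] [cite: SteinWuthrich2013, Thm. 6.1 (p. 20)] -/
theorem bsdp_of_chain_bdd_heightFree [NeZero (W.conductorNorm ℤ / p)]
    {MuAlgZero : MuAlgPred p (W.conductorNorm ℤ / p)} {lamAlg : LamAlgFun p (W.conductorNorm ℤ / p)}
    (hHida : hida_exists_congruent_ordinary_newform_of_multiplicative)
    (hMTT : exists_isCycPAdicLFunctionWeightK)
    (hKato : kato_charIdeal_dvd_multiplicative_of_surjective)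
    (hJs : thm61_splitMultiplicative) (hJn : thm61_nonsplitMultiplicative)
    (hGZK : rank_eq_analyticRank_of_analyticRank_le_one) (hmod : hasEntireLFunction_rat)
    (hpar : nonempty_modularParametrizationData)
    (hGS : greenberg_stevens (W := W) (p := p))
    (h1a : MuAlgTransferAt W p MuAlgZero) (h2 : WanLambdaBddAt W p MuAlgZero lamAlg)
    (h1b : InvariantsTransferBddAt W p MuAlgZero lamAlg)
    (hp : 5 ≤ p) (hmult : W.HasMultiplicativeReductionAtPrime p)
    (hsurj : W.HasSurjectiveModNGaloisRep p) (hr : W.analyticRank = 0) (hμ : MuAnZeroAt W p) :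
    BSDp W p :=
  bsdp_of_invariantsMatchAt_heightFree W p hKato hJs hJn hGZK hmod hpar hGS hp hmult hsurj hr
    (invariantsMatchAt_of_invariantsAt_normLam W p
      (invariantsAt_normLam_of_chain_bdd W p hHida hMTT hKato hpar h1a h2 h1b hp hmult hsurj hμ))

end Summit.BirchSwinnertonDyer.Rank1Residual.X11a.Chain

/-! ### Class-level form on the bounded shapes -/

namespace Summit.BirchSwinnertonDyer.Rank1Residual.X11a

open Chain

/-- **X11a, `p ≥ 5`, surjective image, CLASS LEVEL, through the chain on the BOUNDED shapes,
height-fact-free** (successor of `forall_bsdp_of_chain`): if at every pair of the class the three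
GL₂ statement shapes — EPW Thm. 1 (algebraic) `MuAlgTransferAt`, Wan Thm. 4 rational
`WanLambdaBddAt` and EPW Thm. 1 + 5.1.3 `InvariantsTransferBddAt`, the latter two over THE bounded
`p`-adic `L`-function — hold for SOME algebraic interface, then `BSD(E,p)` holds at every pair
carrying the certificate `μ^an(E,p) = 0`. The Mazur–Tate–Teitelbaum existence fact is the tree
theorem `exists_isCycPAdicLFunctionWeightK_holds`; no Stein–Wuthrich height-existence binder.
Class-level residue = Greenberg's `μ`-conjecture (OPEN, NAMED). No label change.
[cite: EmertonPollackWeston2006, Thm. 1, Thm. 5.1.3, Cor. 5.1.4] [cite: Wan2015, Thm. 4 (pp. 4–5) = Thm. 103 (pp. 91–92)]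
[cite: MazurTateTeitelbaum1986Invent, §I.11 and §I.14 (14.3)] [cite: SteinWuthrich2013, Thm. 6.1 (p. 20)] -/
theorem forall_bsdp_of_chain_bdd_heightFree
    (hHida : hida_exists_congruent_ordinary_newform_of_multiplicative)
    (hKato : kato_charIdeal_dvd_multiplicative_of_surjective)
    (hJs : thm61_splitMultiplicative) (hJn : thm61_nonsplitMultiplicative)
    (hGZK : rank_eq_analyticRank_of_analyticRank_le_one) (hmod : hasEntireLFunction_rat)
    (hpar : nonempty_modularParametrizationData)
    (hGS : ∀ (W : WeierstrassCurve ℚ) [W.IsElliptic] [W.IsGloballyMinimal] (p : ℕ) [Fact p.Prime],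
      greenberg_stevens (W := W) (p := p))
    (hchain : ∀ (W : WeierstrassCurve ℚ) [W.IsElliptic] [W.IsGloballyMinimal] (p : ℕ) [Fact p.Prime]
      [NeZero (W.conductorNorm ℤ / p)], ClassX11a W p → 5 ≤ p → Surj W p →
      ∃ (MuAlgZero : MuAlgPred p (W.conductorNorm ℤ / p))
        (lamAlg : LamAlgFun p (W.conductorNorm ℤ / p)),
        MuAlgTransferAt W p MuAlgZero ∧ WanLambdaBddAt W p MuAlgZero lamAlg ∧
          InvariantsTransferBddAt W p MuAlgZero lamAlg) :
    ∀ (W : WeierstrassCurve ℚ) [W.IsElliptic] [W.IsGloballyMinimal] (p : ℕ) [Fact p.Prime],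
      ClassX11a W p → 5 ≤ p → Surj W p → MuAnZeroAt W p → BSDp W p := by
  intro W _ _ p _ hX hp hsurj hμ
  haveI : NeZero (W.conductorNorm ℤ / p) := neZero_conductorNorm_div W p hX.2.2.1
  obtain ⟨MuAlgZero, lamAlg, h1a, h2, h1b⟩ := hchain W p hX hp hsurj
  exact bsdp_of_chain_bdd_heightFree W p hHida exists_isCycPAdicLFunctionWeightK_holds hKato hJs hJn
    hGZK hmod hpar (hGS W p) h1a h2 h1b hp hX.2.2.1 hsurj hX.1 hμ

end Summit.BirchSwinnertonDyer.Rank1Residual.X11a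

end
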